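import Summits.QuantumFields.YangMills.Theorems.BalabanUVNodesN08AtRecord12
import Literature.MathematicalPhysics.QuantumFieldTheory.Balaban1983to89.Node00.Record12CarriersB13
import Literature.MathematicalPhysics.QuantumFieldTheory.Balaban1983to89.Node00.Record12Residuals
import Literature.MathematicalPhysics.QuantumFieldTheory.Balaban1983to89.Node00.Record12Numerics

/-!
# Route «BalabanUVNodes», Track-A DAG node N08 = [Balaban1985UV3] Thm 1 p. 257 (compact reading) ∧ Thm 2 p. 272 —
# N08 IN THE CURRENCY OF K1′'s REGISTERED STUB `stub_nodes12` (route rev 15, crux `StabilityBAtRecordR12e` = stmt-QuantumFields-19903)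

Cell `pub-ymgap`, seat `pub-ymgap-dag-n08-c` gen 3 (director-ym R134 row N08 s2 «by-name knit at the record of record»; the rev-15 service of
this seat's Stage-12 storey `BalabanUVNodesN08AtRecord12(Sides)`, p466715 ∕ p466777).  Filed `--supports stmt-QuantumFields-19903 --as helper`.

WHY THIS FILE.  Since rev 15 (2026-08-26T20:35:43Z) K1′ reads `∀ F, (∃ θ, θ.Provisos₁₂ F 2 ∧ (θ.ZtUnity F 2 ∧ θ.SlotsNondegenerate) ∧ θ.Admissible F 2) → ∃ θ h, …`
and plan g64's registered stub `stub_nodes12 : Inhabited12 F → NodesAtSomeRecord12 F` (`K1Skeleton12`, rev-15 v2) asks, for the SAME guarded tuple `θ`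
with provisos `h`, SOME world `w` with `Node00.IsRecordOfRecord₁₂C F 2 (Node00.datumOfRecord₁₂ F 2 θ h) w` at which ALL thirteen nodes hold run by run.
The node seats' convention for that stub (dag-n12-d g3 `…N12AtRecord12MassSel` §5, dag-n10-d `…N10AtRecord12B13` §3) is the POINTED closer AT AN
EXPOSED VIEW WORLD `w.up P = Node00.upOfRecord₅C(S) F N (θ.view₁₂… …) P` (node00-def g32 ∕ g33 ∕ def-B13's cumulative carrier views), so that every
node's closer applies at ONE `w`.  This module supplies N08's:
* §1 POINTED CLOSERS at the C-binding over each of the seven Stage-12 views (`view₁₂B10YZW`, `…B8B10YZW`, `…B8subB10YZW`, `…B12B8B10YZW`,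
  `…B12B8subB10YZW`, `…B13B12B8B10YZW`, `…B13B12B8subB10YZW`) and at the S-binding over the six [B8]-carrying ones: `Dag.B10_main (leavesP w P)` from
  the up-equation and THE ONE SLOT INSTANCE
  `Node00.PrintedUV3V N θ.L` — no datum, window, in-edge or residual-layer hypothesis; plus the EXACT readings (`b10_leaf_iff_…`, `b10_main_iff_…`:
  at such a world N08 ⟺ «in-edge leaves → `PrintedUV3V N θ.L`»).
* §2 THE ∃-CURRENCY: at the datum of ANY admissible tuple with provisos, a four-pin world (package exposed) carrying N08, from `PrintedUV3V N θ.L`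
  (`exists_world₁₂C_b10_main_of_slot`, B8-keyed twin `exists_world₁₂CB10YZWB8_b10_main_of_slot`); and LITERALLY `Inhabited12 F →` (N08's conjunct of
  `NodesAtSomeRecord12 F`) with the rev-15 guard `θ.ZtUnity F N ∧ θ.SlotsNondegenerate` riding on `θ` untouched (generic `N`, and `N = 2` in the route
  item's binder text: `exists_guarded_record₁₂C_b10_main_of_inhabited12_two`).
* §3 ON THE K0′ WITNESS LINE OF RECORD (node00-def-K0a's `Node00.theta12OfRecord F N ζ Rz Zt`, block size `L = 3`, `admissible_theta12OfRecord` and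
  `theta12OfRecord_γ = 1∕2` BY NAME): there N08's share of `stub_nodes12` costs K0′'s own provisos and THE SINGLE PROP `Node00.PrintedUV3V N 3`
  (`N = 2`: [Balaban1985UV3] Thm 1-compact ∧ Thm 2 with their printed ∃-prefix for SU(2), block size 3, at some version of print's transformations —
  `exists_world₁₂C_b10_main_at_theta12OfRecord`, exact cost `b10_main_iff_at_theta12OfRecord`).
* §4 THE rev-15 GUARD IS CARRIER-BLIND (kernel `Iff.rfl`): `θ.ZtUnity F N ∧ θ.SlotsNondegenerate` is invariant under `rebindX` and the seven carrier pins
  `pinB10 ∕ pinY ∕ pinZ ∕ pinW ∕ pinB8 ∕ pinB8Sub ∕ pinB12 ∕ pinB13`, hence holds at the quadruply pinned PRESENTING parameter of the ₁₂C refinement of a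
  four-pin record iff at `θ` (`guard_pin4_iff`) — for seats whose node must read the guard at the presenting parameter of a pinned-key record.
HONEST FRAMING: count-neutral kernel bookkeeping BY NAME; nothing of Bałaban's asserted; `PrintedUV3V` is TYPED, NOT PROVED — an inhabitant of it (the
[B10] cluster expansion at print's run objects) remains THE object gap of N08; N08 NOT discharged; K0′ ∕ K1′ neither proved nor assumed beyond the displayed
hypotheses; one finite four-torus per run at fixed `ε`, [B10]'s d = 3 lattices inside the record; nothing continuum ∕ ℝ⁴ ∕ OS ∕ mass gap ∕ Clay.
0 `sorry`, 0 `def`, standard axioms.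
Sources: [Balaban1985UV3] Thm 1 p.257, Thm 2 p.272; [Balaban1989LargeFieldII] Thm 1 + (0.1) pp.355–356; [Balaban1988Convergent] (3.16)–(3.22) pp.268–269;
[Balaban1987RG1] (0.21) p.256.
-/

noncomputable section

namespace Summit.QuantumFields.YangMills.BalabanUVNodes.N08StubNodes12Currency

open Literature.MathematicalPhysics.QuantumFieldTheory.Balaban1983to89
open Literature.MathematicalPhysics.QuantumFieldTheory.Balaban1983to89.T4Continuum (T4Family FiniteEpsData)
open Literature.MathematicalPhysics.QuantumFieldTheory.Balaban1983to89.DagBinding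
  (WorldP leavesP PrintedCarriersR PrintedCarriers9X PrintedCarriers11 PrintedCarriers15)
open Literature.MathematicalPhysics.QuantumFieldTheory.Balaban1983to89.Node00
open Summit.QuantumFields.YangMills.BalabanUVNodes.N06AtRecord9CB10Y (exists_junkOps_b9LeafX_Y9OfRecord)
open scoped Matrix.Norms.L2Operator

variable {F : T4Family} {N : ℕ} [NeZero N]

/-! ## §1 POINTED CLOSERS AT THE EXPOSED VIEW WORLDS — cost: the one slot instance `PrintedUV3V N θ.L` -/

section PointedC
variable {w : WorldP} (θ : Stage12Params F N) (Mstar : ℕ) (ops : OpsY N θ.toStage3Params Mstar) (ζ : ResidZ F N) (lamW : ResidW F N)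

/-- **EXACT READING at the C-binding over the four-pin view**: the run's `b10` leaf IS the slot of record at the tuple's block size. [cite: Balaban1985UV3, Thm 1 p.257, Thm 2 p.272] -/
theorem b10_leaf_iff_of_upC_view₁₂B10YZW (hup : ∀ P, w.up P = upOfRecord₅C F N (θ.view₁₂B10YZW F N Mstar ops ζ lamW) P) (P : B12.RunParams) :
    (leavesP w P).b10 ↔ PrintedUV3V N θ.L := by
  show (w.up P).b10 ↔ _
  rw [hup P]
  exact (upOfRecord₅C_view₁₂B10YZW_leaves F N θ Mstar ops ζ lamW P).2.2.1

/-- **EXACT COST of N08 at such a world**: `Dag.B10_main` there ⟺ «the run's in-edge leaves `b5 b6 b7 b8 b9 b11` ⟹ `PrintedUV3V N θ.L`». [cite: Balaban1985UV3, Thm 1 p.257, Thm 2 p.272] -/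
theorem b10_main_iff_of_upC_view₁₂B10YZW (hup : ∀ P, w.up P = upOfRecord₅C F N (θ.view₁₂B10YZW F N Mstar ops ζ lamW) P) (P : B12.RunParams) :
    Dag.B10_main (leavesP w P) ↔
      ((leavesP w P).b5 → (leavesP w P).b6 → (leavesP w P).b7 → (leavesP w P).b8 → (leavesP w P).b9 → (leavesP w P).b11 → PrintedUV3V N θ.L) := by
  unfold Dag.B10_main
  rw [b10_leaf_iff_of_upC_view₁₂B10YZW θ Mstar ops ζ lamW hup P]

/-- **N08 AT THE C-BINDING OVER THE FOUR-PIN VIEW** (the ₁₂C-class world of `stub_nodes12`'s currency) from the one slot instance `PrintedUV3V N θ.L`; no other binder.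
[cite: Balaban1985UV3, Thm 1 p.257, Thm 2 p.272; Balaban1989LargeFieldII, Thm 1 + (0.1) pp.355–356 (bookkeeping: the record's world)] -/
theorem b10_main_of_upC_view₁₂B10YZW (hup : ∀ P, w.up P = upOfRecord₅C F N (θ.view₁₂B10YZW F N Mstar ops ζ lamW) P) (hUV : PrintedUV3V N θ.L)
    (P : B12.RunParams) : Dag.B10_main (leavesP w P) := by
  intro _ _ _ _ _ _
  exact (b10_leaf_iff_of_upC_view₁₂B10YZW θ Mstar ops ζ lamW hup P).2 hUV

/-- … over the five-pin view with [B8] (the C-bound twin world of a `₁₂CB10YZWB8` record; `view₁₂B8B10YZW = (θ.pinB8 lam).view₁₂B10YZW` definitionally). [cite: Balaban1985UV3, Thm 1 p.257, Thm 2 p.272] -/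
theorem b10_main_of_upC_view₁₂B8B10YZW (lam : ResidB8 θ.toStage3Params)
    (hup : ∀ P, w.up P = upOfRecord₅C F N (θ.view₁₂B8B10YZW F N lam Mstar ops ζ lamW) P) (hUV : PrintedUV3V N θ.L) (P : B12.RunParams) :
    Dag.B10_main (leavesP w P) :=
  b10_main_of_upC_view₁₂B10YZW (θ.pinB8 F N lam) Mstar ops ζ lamW hup hUV P

/-- … over the five-pin view with [B8′]. [cite: Balaban1985UV3, Thm 1 p.257, Thm 2 p.272] -/
theorem b10_main_of_upC_view₁₂B8subB10YZW (lam : ResidB8 θ.toStage3Params)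
    (hup : ∀ P, w.up P = upOfRecord₅C F N (θ.view₁₂B8subB10YZW F N lam Mstar ops ζ lamW) P) (hUV : PrintedUV3V N θ.L) (P : B12.RunParams) :
    Dag.B10_main (leavesP w P) :=
  b10_main_of_upC_view₁₂B10YZW (θ.pinB8Sub F N lam) Mstar ops ζ lamW hup hUV P

/-- … over the six-pin view with [B12], [B8]. [cite: Balaban1985UV3, Thm 1 p.257, Thm 2 p.272] -/
theorem b10_main_of_upC_view₁₂B12B8B10YZW (lam12 : ResidB12 F N θ.τ9.M) (lam : ResidB8 θ.toStage3Params)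
    (hup : ∀ P, w.up P = upOfRecord₅C F N (θ.view₁₂B12B8B10YZW F N lam12 lam Mstar ops ζ lamW) P) (hUV : PrintedUV3V N θ.L) (P : B12.RunParams) :
    Dag.B10_main (leavesP w P) :=
  b10_main_of_upC_view₁₂B10YZW ((θ.pinB12 F N lam12).pinB8 F N lam) Mstar ops ζ lamW hup hUV P

/-- … over the six-pin view with [B12], [B8′]. [cite: Balaban1985UV3, Thm 1 p.257, Thm 2 p.272] -/
theorem b10_main_of_upC_view₁₂B12B8subB10YZW (lam12 : ResidB12 F N θ.τ9.M) (lam : ResidB8 θ.toStage3Params)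
    (hup : ∀ P, w.up P = upOfRecord₅C F N (θ.view₁₂B12B8subB10YZW F N lam12 lam Mstar ops ζ lamW) P) (hUV : PrintedUV3V N θ.L) (P : B12.RunParams) :
    Dag.B10_main (leavesP w P) :=
  b10_main_of_upC_view₁₂B10YZW ((θ.pinB12 F N lam12).pinB8Sub F N lam) Mstar ops ζ lamW hup hUV P

/-- … over def-B13's seven-pin view with [B13], [B12], [B8]. [cite: Balaban1985UV3, Thm 1 p.257, Thm 2 p.272] -/
theorem b10_main_of_upC_view₁₂B13B12B8B10YZW (lam13 : B12.RunParams → ResidB13 θ.toStage3Params) (lam12 : ResidB12 F N θ.τ9.M)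
    (lam : ResidB8 θ.toStage3Params)
    (hup : ∀ P, w.up P = upOfRecord₅C F N (θ.view₁₂B13B12B8B10YZW F N lam13 lam12 lam Mstar ops ζ lamW) P) (hUV : PrintedUV3V N θ.L)
    (P : B12.RunParams) : Dag.B10_main (leavesP w P) :=
  b10_main_of_upC_view₁₂B10YZW (((θ.pinB13 F N lam13).pinB12 F N lam12).pinB8 F N lam) Mstar ops ζ lamW hup hUV P

/-- … over the seven-pin view with [B13], [B12], [B8′]. [cite: Balaban1985UV3, Thm 1 p.257, Thm 2 p.272] -/
theorem b10_main_of_upC_view₁₂B13B12B8subB10YZW (lam13 : B12.RunParams → ResidB13 θ.toStage3Params) (lam12 : ResidB12 F N θ.τ9.M)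
    (lam : ResidB8 θ.toStage3Params)
    (hup : ∀ P, w.up P = upOfRecord₅C F N (θ.view₁₂B13B12B8subB10YZW F N lam13 lam12 lam Mstar ops ζ lamW) P) (hUV : PrintedUV3V N θ.L)
    (P : B12.RunParams) : Dag.B10_main (leavesP w P) :=
  b10_main_of_upC_view₁₂B10YZW (((θ.pinB13 F N lam13).pinB12 F N lam12).pinB8Sub F N lam) Mstar ops ζ lamW hup hUV P

end PointedC

section PointedS
variable {w : WorldP} (θ : Stage12Params F N) (lam : ResidB8 θ.toStage3Params) (Mstar : ℕ) (ops : OpsY N θ.toStage3Params Mstar) (ζ : ResidZ F N)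
  (lamW : ResidW F N)

/-- **EXACT READING at the S-binding over the five-pin view** (the world of a `₁₂CB10YZWB8` record): the run's `b10` leaf IS `PrintedUV3V N θ.L`. [cite: Balaban1985UV3, Thm 1 p.257, Thm 2 p.272] -/
theorem b10_leaf_iff_of_upS_view₁₂B8B10YZW (hup : ∀ P, w.up P = upOfRecord₅CS F N (θ.view₁₂B8B10YZW F N lam Mstar ops ζ lamW) P) (P : B12.RunParams) :
    (leavesP w P).b10 ↔ PrintedUV3V N θ.L := by
  show (w.up P).b10 ↔ _
  rw [hup P]
  exact (upOfRecord₅CS_view₁₂B8B10YZW_leaves F N θ lam Mstar ops ζ lamW P).2.2.2.1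

/-- **N08 AT THE S-BINDING OVER THE FIVE-PIN VIEW** from `PrintedUV3V N θ.L`; no other binder. [cite: Balaban1985UV3, Thm 1 p.257, Thm 2 p.272; Balaban1989LargeFieldII, Thm 1 + (0.1) pp.355–356 (bookkeeping)] -/
theorem b10_main_of_upS_view₁₂B8B10YZW (hup : ∀ P, w.up P = upOfRecord₅CS F N (θ.view₁₂B8B10YZW F N lam Mstar ops ζ lamW) P) (hUV : PrintedUV3V N θ.L)
    (P : B12.RunParams) : Dag.B10_main (leavesP w P) := by
  intro _ _ _ _ _ _
  exact (b10_leaf_iff_of_upS_view₁₂B8B10YZW θ lam Mstar ops ζ lamW hup P).2 hUV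

/-- … over the five-pin view with [B8′]. [cite: Balaban1985UV3, Thm 1 p.257, Thm 2 p.272] -/
theorem b10_main_of_upS_view₁₂B8subB10YZW (hup : ∀ P, w.up P = upOfRecord₅CS F N (θ.view₁₂B8subB10YZW F N lam Mstar ops ζ lamW) P)
    (hUV : PrintedUV3V N θ.L) (P : B12.RunParams) : Dag.B10_main (leavesP w P) := by
  intro _ _ _ _ _ _
  show (w.up P).b10
  rw [hup P]
  exact (upOfRecord₅CS_view₁₂B8subB10YZW_leaves F N θ lam Mstar ops ζ lamW P).2.2.2.1.2 hUV

/-- … over the six-pin view with [B12], [B8] (`= (θ.pinB12 lam12).view₁₂B8B10YZW` definitionally). [cite: Balaban1985UV3, Thm 1 p.257, Thm 2 p.272] -/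
theorem b10_main_of_upS_view₁₂B12B8B10YZW (lam12 : ResidB12 F N θ.τ9.M)
    (hup : ∀ P, w.up P = upOfRecord₅CS F N (θ.view₁₂B12B8B10YZW F N lam12 lam Mstar ops ζ lamW) P) (hUV : PrintedUV3V N θ.L) (P : B12.RunParams) :
    Dag.B10_main (leavesP w P) :=
  b10_main_of_upS_view₁₂B8B10YZW (θ.pinB12 F N lam12) lam Mstar ops ζ lamW hup hUV P

/-- … over the six-pin view with [B12], [B8′]. [cite: Balaban1985UV3, Thm 1 p.257, Thm 2 p.272] -/
theorem b10_main_of_upS_view₁₂B12B8subB10YZW (lam12 : ResidB12 F N θ.τ9.M)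
    (hup : ∀ P, w.up P = upOfRecord₅CS F N (θ.view₁₂B12B8subB10YZW F N lam12 lam Mstar ops ζ lamW) P) (hUV : PrintedUV3V N θ.L)
    (P : B12.RunParams) : Dag.B10_main (leavesP w P) :=
  b10_main_of_upS_view₁₂B8subB10YZW (θ.pinB12 F N lam12) lam Mstar ops ζ lamW hup hUV P

/-- … over def-B13's seven-pin view with [B13], [B12], [B8] (the world of a `₁₂CB10YZWB8B12B13` record). [cite: Balaban1985UV3, Thm 1 p.257, Thm 2 p.272] -/
theorem b10_main_of_upS_view₁₂B13B12B8B10YZW (lam13 : B12.RunParams → ResidB13 θ.toStage3Params) (lam12 : ResidB12 F N θ.τ9.M)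
    (hup : ∀ P, w.up P = upOfRecord₅CS F N (θ.view₁₂B13B12B8B10YZW F N lam13 lam12 lam Mstar ops ζ lamW) P) (hUV : PrintedUV3V N θ.L)
    (P : B12.RunParams) : Dag.B10_main (leavesP w P) :=
  b10_main_of_upS_view₁₂B8B10YZW ((θ.pinB13 F N lam13).pinB12 F N lam12) lam Mstar ops ζ lamW hup hUV P

/-- … over the seven-pin view with [B13], [B12], [B8′]. [cite: Balaban1985UV3, Thm 1 p.257, Thm 2 p.272] -/
theorem b10_main_of_upS_view₁₂B13B12B8subB10YZW (lam13 : B12.RunParams → ResidB13 θ.toStage3Params) (lam12 : ResidB12 F N θ.τ9.M)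
    (hup : ∀ P, w.up P = upOfRecord₅CS F N (θ.view₁₂B13B12B8subB10YZW F N lam13 lam12 lam Mstar ops ζ lamW) P) (hUV : PrintedUV3V N θ.L)
    (P : B12.RunParams) : Dag.B10_main (leavesP w P) :=
  b10_main_of_upS_view₁₂B8subB10YZW ((θ.pinB13 F N lam13).pinB12 F N lam12) lam Mstar ops ζ lamW hup hUV P

end PointedS

/-! ## §2 THE ∃-CURRENCY OF `stub_nodes12` — N08's conjunct of `NodesAtSomeRecord12`, the rev-15 guard riding on `θ` -/

section Currency

/-- **AT THE DATUM OF ANY ADMISSIBLE STAGE-12 TUPLE WITH PROVISOS, a four-pin world (package EXPOSED: any floor `Mstar`, operator layer `ops`, [B11] layer `ζ`, [IV] layer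
`lamW`, any window height `γw`) that is a `₁₂C` AND a `₁₂CB10YZW` record of `datumOfRecord₁₂ F N θ h` and carries N08 at every run — from the one slot instance
`PrintedUV3V N θ.L`.**  The world is def-T's (`exists_world_isRecordOfRecord₁₂C`) with the upstream block re-bound to g32's four-pin C-binding; ₁₂C through g33's
refinement `isRecordOfRecord₁₂C_of_isRecordOfRecord₁₂CB10YZW`.  The other twelve nodes' pointed closers apply AT THIS `w`. [cite: Balaban1985UV3, Thm 1 p.257, Thm 2 p.272; Balaban1989LargeFieldII, Thm 1 + (0.1) pp.355–356 (the record's world; bookkeeping)] -/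
theorem exists_world₁₂C_b10_main_of_slot (θ : Stage12Params F N) (h : θ.Provisos₁₂ F N) (hθ : θ.Admissible F N) (Mstar : ℕ)
    (ops : OpsY N θ.toStage3Params Mstar) (ζ : ResidZ F N) (lamW : ResidW F N) {γw : ℝ} (hγw : 0 < γw ∧ γw ≤ θ.γ) (hUV : PrintedUV3V N θ.L) :
    ∃ w : WorldP, IsRecordOfRecord₁₂C F N (datumOfRecord₁₂ F N θ h) w ∧ IsRecordOfRecord₁₂CB10YZW F N (datumOfRecord₁₂ F N θ h) w ∧
      w.γ = γw ∧ w.L = (θ.L : ℝ) ∧ (∀ P, w.up P = upOfRecord₅C F N (θ.view₁₂B10YZW F N Mstar ops ζ lamW) P) ∧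
      ∀ P : B12.RunParams, Dag.B10_main (leavesP w P) := by
  obtain ⟨w₀, -, -⟩ := exists_world_isRecordOfRecord₁₂C F N θ h hθ hγw
  have hL1 : (1 : ℝ) < (θ.L : ℝ) := by exact_mod_cast θ.hL.2
  have hR : IsRecordOfRecord₁₂CB10YZW F N (datumOfRecord₁₂ F N θ h)
      { w₀ with C := (datumOfRecord₁₂ F N θ h).C, γ := γw, L := (θ.L : ℝ), one_lt_L := hL1, up := fun P => upOfRecord₅C F N (θ.view₁₂B10YZW F N Mstar ops ζ lamW) P } :=
    ⟨θ, h, Mstar, ops, ζ, lamW, hθ, rfl, rfl, hγw, rfl, fun _ => rfl⟩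
  exact ⟨_, isRecordOfRecord₁₂C_of_isRecordOfRecord₁₂CB10YZW hR, hR, rfl, rfl, fun _ => rfl,
    b10_main_of_upC_view₁₂B10YZW θ Mstar ops ζ lamW (fun _ => rfl) hUV⟩

/-- **The [B8]-keyed twin**: at the same datum, a five-pin S-binding world (package exposed, [B8] layer `lam`) that is a `₁₂CB10YZWB8` record and carries N08 at every run,
from `PrintedUV3V N θ.L` (g33's `exists_world_isRecordOfRecord₁₂CB10YZWB8` shape with the up-equation kept). [cite: Balaban1985UV3, Thm 1 p.257, Thm 2 p.272; Balaban1989LargeFieldII, Thm 1 + (0.1) pp.355–356 (bookkeeping)] -/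
theorem exists_world₁₂CB10YZWB8_b10_main_of_slot (θ : Stage12Params F N) (h : θ.Provisos₁₂ F N) (hθ : θ.Admissible F N)
    (lam : ResidB8 θ.toStage3Params) (Mstar : ℕ) (ops : OpsY N θ.toStage3Params Mstar) (ζ : ResidZ F N) (lamW : ResidW F N) {γw : ℝ}
    (hγw : 0 < γw ∧ γw ≤ θ.γ) (hUV : PrintedUV3V N θ.L) :
    ∃ w : WorldP, IsRecordOfRecord₁₂CB10YZWB8 F N (datumOfRecord₁₂ F N θ h) w ∧
      w.γ = γw ∧ w.L = (θ.L : ℝ) ∧ (∀ P, w.up P = upOfRecord₅CS F N (θ.view₁₂B8B10YZW F N lam Mstar ops ζ lamW) P) ∧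
      ∀ P : B12.RunParams, Dag.B10_main (leavesP w P) := by
  obtain ⟨w₀, -, -⟩ := exists_world_isRecordOfRecord₁₂C F N θ h hθ hγw
  have hL1 : (1 : ℝ) < (θ.L : ℝ) := by exact_mod_cast θ.hL.2
  have hR : IsRecordOfRecord₁₂CB10YZWB8 F N (datumOfRecord₁₂ F N θ h)
      { w₀ with C := (datumOfRecord₁₂ F N θ h).C, γ := γw, L := (θ.L : ℝ), one_lt_L := hL1, up := fun P => upOfRecord₅CS F N (θ.view₁₂B8B10YZW F N lam Mstar ops ζ lamW) P } :=
    ⟨θ, h, lam, Mstar, ops, ζ, lamW, hθ, rfl, rfl, hγw, rfl, fun _ => rfl⟩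
  exact ⟨_, hR, rfl, rfl, fun _ => rfl, b10_main_of_upS_view₁₂B8B10YZW θ lam Mstar ops ζ lamW (fun _ => rfl) hUV⟩

/-- **`Inhabited12 F →` (N08's CONJUNCT OF `NodesAtSomeRecord12 F`)**, generic `N`: from K0′'s rev-15 conclusion at `F` (HYPOTHESIS `hI`; the rev-15 guard
`θ.ZtUnity F N ∧ θ.SlotsNondegenerate` bundled as ONE conjunct, carried to the SAME `θ` untouched) and the slot of record at every odd `L > 1` (HYPOTHESIS `hUV`,
the node's object gap), SOME guarded admissible tuple `θ`, provisos `h` and world `w` with `IsRecordOfRecord₁₂C F N (datumOfRecord₁₂ F N θ h) w` and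
`Dag.B10_main` at every run.  Floor `0`, N06's junk operator layer (`exists_junkOps_b9LeafX_Y9OfRecord`), degenerate [B11] ∕ [IV] layers, `γw := θ.γ`.  NOT the
stub (twelve conjuncts missing), NOT a discharge. [cite: Balaban1985UV3, Thm 1 p.257, Thm 2 p.272; Balaban1989LargeFieldII, Thm 1 + (0.1) pp.355–356; Balaban1988Convergent, (3.16)–(3.22) pp.268–269 (the guard; bookkeeping)] -/
theorem exists_guarded_record₁₂C_b10_main_of_inhabited12
    (hI : ∃ θ : Stage12Params F N, θ.Provisos₁₂ F N ∧ (θ.ZtUnity F N ∧ θ.SlotsNondegenerate) ∧ θ.Admissible F N)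
    (hUV : ∀ L : ℕ, Odd L → 1 < L → PrintedUV3V N L) :
    ∃ (θ : Stage12Params F N) (h : θ.Provisos₁₂ F N) (w : WorldP), (θ.ZtUnity F N ∧ θ.SlotsNondegenerate) ∧ θ.Admissible F N ∧
      IsRecordOfRecord₁₂C F N (datumOfRecord₁₂ F N θ h) w ∧ ∀ P : B12.RunParams, Dag.B10_main (leavesP w P) := by
  obtain ⟨θ, h, hG, hθ⟩ := hI
  obtain ⟨ops, -, -⟩ := exists_junkOps_b9LeafX_Y9OfRecord (N := N) θ.toStage3Params hθ.1.1.1.1.1 0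
  obtain ⟨ζ⟩ := nonempty_residZ F N
  obtain ⟨lamW⟩ := nonempty_residW F N
  obtain ⟨w, hC, -, -, -, -, hN⟩ :=
    exists_world₁₂C_b10_main_of_slot θ h hθ 0 ops ζ lamW ⟨hθ.toStage9.gamma_pos, le_rfl⟩ (hUV θ.L θ.hL.1 θ.hL.2)
  exact ⟨θ, h, w, hG, hθ, hC, hN⟩

/-- **THE SAME AT THE GROUP OF RECORD `N = 2`, hypothesis = K1′'s antecedent VERBATIM** (route file rev 15 :292, `StabilityBAtRecordR12e` = stmt-QuantumFields-19903;
plan g64's `K1Skeleton12.Inhabited12 F`): N08's conjunct of `NodesAtSomeRecord12 F` from it and the slot at every odd `L > 1`.  NOT the stub, NOT a discharge.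
[cite: Balaban1985UV3, Thm 1 p.257, Thm 2 p.272; Balaban1989LargeFieldII, Thm 1 + (0.1) pp.355–356 (bookkeeping)] -/
theorem exists_guarded_record₁₂C_b10_main_of_inhabited12_two (F : T4Family)
    (hI : ∃ θ : Stage12Params F 2, θ.Provisos₁₂ F 2 ∧ (θ.ZtUnity F 2 ∧ θ.SlotsNondegenerate) ∧ θ.Admissible F 2)
    (hUV : ∀ L : ℕ, Odd L → 1 < L → PrintedUV3V 2 L) :
    ∃ (θ : Stage12Params F 2) (h : θ.Provisos₁₂ F 2) (w : WorldP), (θ.ZtUnity F 2 ∧ θ.SlotsNondegenerate) ∧ θ.Admissible F 2 ∧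
      IsRecordOfRecord₁₂C F 2 (datumOfRecord₁₂ F 2 θ h) w ∧ ∀ P : B12.RunParams, Dag.B10_main (leavesP w P) :=
  exists_guarded_record₁₂C_b10_main_of_inhabited12 hI hUV

end Currency

/-! ## §3 ON THE K0′ WITNESS LINE OF RECORD `θ₀ = theta12OfRecord F N ζ Rz Zt` (block size 3) — N08's share costs `PrintedUV3V N 3` -/

section WitnessLine
variable (ζ : ZetaOfRecord F N numerics7OfRecord₁₂ 1) (Rz : (K : ℕ) → Sect2.Residual (F.P K) (MatA N)) (Zt : (K : ℕ) → TkResidualW F N (FluctV N) K)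

/-- **The K0′ witness of record has Bałaban's block size `L = 3`** (node00-def-K0a's `stage3OfRecord₁₂_L`, here read at `θ₀`; `rfl`). [cite: Balaban1987RG1, (0.21) p.256 (the numerics of record; bookkeeping)] -/
theorem theta12OfRecord_L : (theta12OfRecord F N ζ Rz Zt).L = 3 := rfl

/-- **N08's SHARE OF `stub_nodes12` ON THE WITNESS LINE OF RECORD COSTS THE SINGLE PROP `PrintedUV3V N 3`** (plus K0′'s own provisos `hP` at `θ₀`, HYPOTHESIS — K0′'s
registered stubs; admissibility is node00-def-K0a's THEOREM `admissible_theta12OfRecord`, the window height is `θ₀.γ = 1∕2`): a four-pin world of `datumOfRecord₁₂ F N θ₀ hP`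
(package exposed, `w.γ = 1∕2`, `w.L = 3`) that is a `₁₂C` and a `₁₂CB10YZW` record and carries N08 at every run.  At `N = 2`: [Balaban1985UV3] Thm 1-compact ∧ Thm 2 with their
printed ∃-prefix for SU(2), block size 3, at some version of print's transformations. [cite: Balaban1985UV3, Thm 1 p.257, Thm 2 p.272; Balaban1989LargeFieldII, Thm 1 + (0.1) pp.355–356; Balaban1987RG1, (0.21) p.256 (bookkeeping)] -/
theorem exists_world₁₂C_b10_main_at_theta12OfRecord (hP : (theta12OfRecord F N ζ Rz Zt).Provisos₁₂ F N) (Mstar : ℕ)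
    (ops : OpsY N (theta12OfRecord F N ζ Rz Zt).toStage3Params Mstar) (ζ' : ResidZ F N) (lamW : ResidW F N) (hUV : PrintedUV3V N 3) :
    ∃ w : WorldP, IsRecordOfRecord₁₂C F N (datumOfRecord₁₂ F N (theta12OfRecord F N ζ Rz Zt) hP) w ∧
      IsRecordOfRecord₁₂CB10YZW F N (datumOfRecord₁₂ F N (theta12OfRecord F N ζ Rz Zt) hP) w ∧ w.γ = 1 / 2 ∧ w.L = 3 ∧
      (∀ P, w.up P = upOfRecord₅C F N ((theta12OfRecord F N ζ Rz Zt).view₁₂B10YZW F N Mstar ops ζ' lamW) P) ∧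
      ∀ P : B12.RunParams, Dag.B10_main (leavesP w P) := by
  obtain ⟨w, hC, hR, hγ, hL, hup, hN⟩ := exists_world₁₂C_b10_main_of_slot (theta12OfRecord F N ζ Rz Zt) hP (admissible_theta12OfRecord F N ζ Rz Zt)
    Mstar ops ζ' lamW (γw := 1 / 2) ⟨one_half_pos, (theta12OfRecord_γ F N ζ Rz Zt).symm.le⟩ hUV
  exact ⟨w, hC, hR, hγ, by rw [hL, theta12OfRecord_L]; norm_num, hup, hN⟩

/-- **EXACT COST ON THE LINE**: at any world whose upstream block is the four-pin C-binding of `θ₀`, N08 at a run ⟺ «in-edge leaves ⟹ `PrintedUV3V N 3`». [cite: Balaban1985UV3, Thm 1 p.257, Thm 2 p.272] -/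
theorem b10_main_iff_at_theta12OfRecord {w : WorldP} (Mstar : ℕ) (ops : OpsY N (theta12OfRecord F N ζ Rz Zt).toStage3Params Mstar) (ζ' : ResidZ F N)
    (lamW : ResidW F N) (hup : ∀ P, w.up P = upOfRecord₅C F N ((theta12OfRecord F N ζ Rz Zt).view₁₂B10YZW F N Mstar ops ζ' lamW) P) (P : B12.RunParams) :
    Dag.B10_main (leavesP w P) ↔
      ((leavesP w P).b5 → (leavesP w P).b6 → (leavesP w P).b7 → (leavesP w P).b8 → (leavesP w P).b9 → (leavesP w P).b11 → PrintedUV3V N 3) :=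
  b10_main_iff_of_upC_view₁₂B10YZW (theta12OfRecord F N ζ Rz Zt) Mstar ops ζ' lamW hup P

end WitnessLine

/-! ## §4 THE rev-15 GUARD IS CARRIER-BLIND (kernel `Iff.rfl`): invariant under `rebindX` and the seven carrier pins -/

section Guard
variable (θ : Stage12Params F N)

/-- The guard `ZtUnity ∧ SlotsNondegenerate` is unchanged by re-binding the run-indexed carrier bundle `X` (`Iff.rfl`: it reads `Zt`, `ν`, `τ9`, `ppSel` and the Stage-9 machine side only). [cite: Balaban1988Convergent, (3.16)–(3.22) pp.268–269 (bookkeeping)] -/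
theorem guard_rebindX_iff (X' : B12.RunParams → PrintedCarriersR) :
    ((θ.rebindX F N X').ZtUnity F N ∧ (θ.rebindX F N X').SlotsNondegenerate) ↔ (θ.ZtUnity F N ∧ θ.SlotsNondegenerate) := Iff.rfl

/-- … by the [B10] pin (`Iff.rfl`). [cite: Balaban1988Convergent, (3.16)–(3.22) pp.268–269; Balaban1985UV3, (1)–(5) p.256 (bookkeeping)] -/
theorem guard_pinB10_iff : ((θ.pinB10 F N).ZtUnity F N ∧ (θ.pinB10 F N).SlotsNondegenerate) ↔ (θ.ZtUnity F N ∧ θ.SlotsNondegenerate) := Iff.rfl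

/-- … by the Y pin (`Iff.rfl`). [cite: Balaban1988Convergent, (3.16)–(3.22) pp.268–269 (bookkeeping)] -/
theorem guard_pinY_iff (Y₀ : PrintedCarriers9X) :
    ((θ.pinY F N Y₀).ZtUnity F N ∧ (θ.pinY F N Y₀).SlotsNondegenerate) ↔ (θ.ZtUnity F N ∧ θ.SlotsNondegenerate) := Iff.rfl

/-- … by the Z pin (`Iff.rfl`). [cite: Balaban1988Convergent, (3.16)–(3.22) pp.268–269 (bookkeeping)] -/
theorem guard_pinZ_iff (Z₀ : PrintedCarriers11) :
    ((θ.pinZ F N Z₀).ZtUnity F N ∧ (θ.pinZ F N Z₀).SlotsNondegenerate) ↔ (θ.ZtUnity F N ∧ θ.SlotsNondegenerate) := Iff.rfl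

/-- … by the W pin (`Iff.rfl`). [cite: Balaban1988Convergent, (3.16)–(3.22) pp.268–269 (bookkeeping)] -/
theorem guard_pinW_iff (W₀ : B12.RunParams → PrintedCarriers15) :
    ((θ.pinW F N W₀).ZtUnity F N ∧ (θ.pinW F N W₀).SlotsNondegenerate) ↔ (θ.ZtUnity F N ∧ θ.SlotsNondegenerate) := Iff.rfl

/-- … by the [B8] and [B8′] pins (`Iff.rfl` ×2). [cite: Balaban1988Convergent, (3.16)–(3.22) pp.268–269 (bookkeeping)] -/
theorem guard_pinB8_iff (lam : ResidB8 θ.toStage3Params) :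
    (((θ.pinB8 F N lam).ZtUnity F N ∧ (θ.pinB8 F N lam).SlotsNondegenerate) ↔ (θ.ZtUnity F N ∧ θ.SlotsNondegenerate)) ∧
    (((θ.pinB8Sub F N lam).ZtUnity F N ∧ (θ.pinB8Sub F N lam).SlotsNondegenerate) ↔ (θ.ZtUnity F N ∧ θ.SlotsNondegenerate)) := ⟨Iff.rfl, Iff.rfl⟩

/-- … by the [B12] pin (`Iff.rfl`). [cite: Balaban1988Convergent, (3.16)–(3.22) pp.268–269 (bookkeeping)] -/
theorem guard_pinB12_iff (lam12 : ResidB12 F N θ.τ9.M) :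
    ((θ.pinB12 F N lam12).ZtUnity F N ∧ (θ.pinB12 F N lam12).SlotsNondegenerate) ↔ (θ.ZtUnity F N ∧ θ.SlotsNondegenerate) := Iff.rfl

/-- … by def-B13's [B13] pin (`Iff.rfl`). [cite: Balaban1988Convergent, (3.16)–(3.22) pp.268–269 (bookkeeping)] -/
theorem guard_pinB13_iff (lam13 : B12.RunParams → ResidB13 θ.toStage3Params) :
    ((θ.pinB13 F N lam13).ZtUnity F N ∧ (θ.pinB13 F N lam13).SlotsNondegenerate) ↔ (θ.ZtUnity F N ∧ θ.SlotsNondegenerate) := Iff.rfl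

/-- **… hence at the QUADRUPLY PINNED PRESENTING PARAMETER of the ₁₂C refinement of a four-pin record** (g33's witness in `isRecordOfRecord₁₂C_of_isRecordOfRecord₁₂CB10YZW`)
the guard holds iff it holds at `θ` (`Iff.rfl`). [cite: Balaban1988Convergent, (3.16)–(3.22) pp.268–269; Balaban1989LargeFieldII, Thm 1 + (0.1) pp.355–356 (bookkeeping)] -/
theorem guard_pin4_iff (Mstar : ℕ) (ops : OpsY N θ.toStage3Params Mstar) (ζ : ResidZ F N) (lamW : ResidW F N) :
    (((((θ.pinB10 F N).pinY F N (Y9OfRecord N θ.toStage3Params Mstar ops)).pinZ F N (Z11OfRecord F N ζ)).pinW F N (WOfRecord₁₂ F N θ lamW)).ZtUnity F N ∧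
      ((((θ.pinB10 F N).pinY F N (Y9OfRecord N θ.toStage3Params Mstar ops)).pinZ F N (Z11OfRecord F N ζ)).pinW F N (WOfRecord₁₂ F N θ lamW)).SlotsNondegenerate) ↔
      (θ.ZtUnity F N ∧ θ.SlotsNondegenerate) := by
  rw [guard_pinW_iff, guard_pinZ_iff, guard_pinY_iff, guard_pinB10_iff]

end Guard

end Summit.QuantumFields.YangMills.BalabanUVNodes.N08StubNodes12Currency

end
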